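import Summits.ResolutionOfSingularities.ResolutionOfSingularities.Theorems.LossEntryW09
import HarnessLib

/-!
# LossEntryW10 — walk plumbing of the loss→entry law `LawLossEntry`, part 10/11

decomp-res-lens-3, gen 29 (HOME/decomp-res-lens-3/g29/NODE-g29.md).  TOOL at 0 toward the residual item
stmt-ResolutionOfSingularities-27367 (`WallCut.NoLossyStrictTailsDeep` ⟸ `LossEpisode.LawLossEntry`).  Imports part 9 (`Theorems.LossEntryW09`, to be landed first).

Contents: §15 `shears_a2_eq_swapShear`, LAW `lawLossEntryAt_of_loss_a2` ((a)-loss + repeat in the chart `l`, via the swap of a (c)-type preparation).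
-/

open MvPolynomial Finset
open Literature.AlgebraicGeometry.Resolution
open Literature.AlgebraicGeometry.Resolution.Hauser2010
open Literature.AlgebraicGeometry.Resolution.PointBlowup
open Summit.ResolutionOfSingularities.ResolutionOfSingularities.Theorems.TightDefectClasses
open Summit.ResolutionOfSingularities.ResolutionOfSingularities.Theorems.TightDefectStrongWalks
open Summit.ResolutionOfSingularities.ResolutionOfSingularities.Theorems.ItineraryCutClasses
open Summit.ResolutionOfSingularities.ResolutionOfSingularities.Theorems.BoundaryLedger
open Summit.ResolutionOfSingularities.ResolutionOfSingularities.Theorems.ProximityCut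
open Summit.ResolutionOfSingularities.ResolutionOfSingularities.Theorems.LossIsFatalLayer (chartMap chartMap_X chartMap_X_self
  chartMap_X_ne chartMap_C)
open Summit.ResolutionOfSingularities.ResolutionOfSingularities.Theorems.LossExitCone
open Summit.ResolutionOfSingularities.ResolutionOfSingularities.Theorems.LossPolygon

/-! ## §15 The walk after an (a)-loss followed by a repeat in the chart `l`: swap of a (c)-type preparation -/

namespace Summit.ResolutionOfSingularities.ResolutionOfSingularities.Theorems.LossPolygon

variable {K : Type} [Field K] [DecidableEq K]
variable {q : ℕ}

omit [DecidableEq K] in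
/-- **THE (a)-PRESENTATION CONTINUED IN THE CHART `l` IS A SWAP OF A (c)-TYPE PREPARATION (PROVED):** for `λ μ' = 1` and
`φ β = 1`, `σ_{j,l,μ'} σ_{j,i,β} σ_{l,i,λβ} F = swapShear_{i,l,μ'φ,λβ} (σ_{i,l,μ'φ} σ_{j,l,μ'} F)`. [new; elementary] -/
theorem shears_a2_eq_swapShear {i j l : Fin 3} (hij : i ≠ j) (hil : i ≠ l) (hjl : j ≠ l) {lam μ' φ β : K}
    (hlμ : lam * μ' = 1) (hφβ : φ * β = 1) (F : MvPolynomial (Fin 3) K) :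
    shear j l μ' (shear j i β (shear l i (lam * β) F)) =
      swapShear i l (μ' * φ) (lam * β) (shear i l (μ' * φ) (shear j l μ' F)) := by
  have hγg : μ' * φ * (lam * β) = 1 := by
    calc μ' * φ * (lam * β) = (lam * μ') * (φ * β) := by ring
      _ = 1 := by rw [hlμ, hφβ, one_mul]
  have key : ((shear (K := K) j l μ').comp (shear j i β)).comp (shear l i (lam * β)) =
      ((swapShear i l (μ' * φ) (lam * β)).comp (shear i l (μ' * φ))).comp (shear j l μ') := by
    refine MvPolynomial.algHom_ext fun w => ?_
    rw [AlgHom.comp_apply, AlgHom.comp_apply, AlgHom.comp_apply, AlgHom.comp_apply]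
    rcases fin3_eq_or i j l w hij hil hjl with h | h | h <;> rw [h]
    · rw [shear_X l i _ i, if_neg hil, shear_X j i β i, if_neg hij, shear_X j l μ' i, if_neg hij,
        shear_X i l _ i, if_pos rfl, map_add, map_mul (swapShear i l (μ' * φ) (lam * β)), algHom_C, algebraMap_eq,
        swapShear_X i l _ _ i, if_pos rfl, swapShear_X i l _ _ l, if_neg (Ne.symm hil), if_pos rfl, map_neg]
      calc (X i : MvPolynomial (Fin 3) K) = C (μ' * φ * (lam * β)) * X i := by rw [hγg, C_1, one_mul]
        _ = _ := by rw [map_mul]; ring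
    · rw [shear_X l i _ j, if_neg hjl, shear_X j i β j, if_pos rfl, map_add, map_mul (shear j l μ'), algHom_C,
        algebraMap_eq, shear_X j l μ' j, if_pos rfl, shear_X j l μ' i, if_neg hij,
        map_add, map_mul (shear i l (μ' * φ)), algHom_C, algebraMap_eq, shear_X i l _ j, if_neg (Ne.symm hij),
        shear_X i l _ l, if_neg (Ne.symm hil), map_add, map_mul (swapShear i l (μ' * φ) (lam * β)), algHom_C,
        algebraMap_eq, swapShear_X i l _ _ j, if_neg (Ne.symm hij), if_neg hjl, swapShear_X i l _ _ l, if_neg (Ne.symm hil),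
        if_pos rfl]
      have hC : (C β : MvPolynomial (Fin 3) K) = C μ' * C (lam * β) := by
        rw [← map_mul, ← mul_assoc, mul_comm μ' lam, hlμ, one_mul]
      rw [hC]
      ring
    · rw [shear_X l i _ l, if_pos rfl, map_add, map_mul (shear j i β), algHom_C, algebraMap_eq, shear_X j i β l,
        if_neg (Ne.symm hjl), shear_X j i β i, if_neg hij, map_add, map_mul (shear j l μ'), algHom_C, algebraMap_eq,
        shear_X j l μ' l, if_neg (Ne.symm hjl), shear_X j l μ' i, if_neg hij,
        shear_X i l _ l, if_neg (Ne.symm hil), swapShear_X i l _ _ l, if_neg (Ne.symm hil), if_pos rfl]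
  have h := congrArg (fun f : MvPolynomial (Fin 3) K →ₐ[K] MvPolynomial (Fin 3) K => f F) key
  simpa only [AlgHom.comp_apply] using h

end Summit.ResolutionOfSingularities.ResolutionOfSingularities.Theorems.LossPolygon

namespace Summit.ResolutionOfSingularities.ResolutionOfSingularities.Theorems.LossEpisode

open Summit.ResolutionOfSingularities.ResolutionOfSingularities.Theorems.LossPolygon

variable {K : Type} [Field K] [DecidableEq K] {q : ℕ} {s₀ : State (Fin 3) K}

section WalkA2

variable {W : ForcedWalk q s₀} {N s : ℕ}

/-- **LAW (L_E), CASE (a2) (PROVED): LOSS IN THE CHART OF THE RUN LETTER + REPEAT IN THE CHART `l` ⇒ STRICTLY SMALLER `β`.**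
From a heavy run state `(i,j,l;k,m)` on the tail, an (a)-loss at `t` (`j_t = i`, `b_t(j) = β ≠ 0`, `b_t(l) = λβ`) followed by a
proximity repeat in the chart `l` lands at `t + 2` in the run state `(l, i, j ; d, T)` with `β_{t+2} < β_t`.  The repeat is
FORCED to translate by `b_{t+1}(j) = μ'` with `λ μ' = 1` (`coeff_shears_a2_apex`; in particular `λ ≠ 0`); then
`F_{t+2} = clean chart_l clean chart_i G₂` with `G₂ = σ_{j,l,μ'} G_a = swapShear_{i,l,μ'/β,λβ} G_c'`,
`G_c' = σ_{i,l,μ'/β} σ_{j,l,μ'} F_t` a (c)-type preparation, whose entry set has the vertex of that of the (b)-type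
`G_b = σ_{i,j,1/β} σ_{l,j,λ} F_t` (§10 chain: swap `(j,l)` and outer shear); T8b for `G_b` concludes. [new] -/
theorem lawLossEntryAt_of_loss_a2 (hroot : IsRoot q s₀) (hT : TailHyp W N s)
    (hLucas : ∀ D T : ℕ, q ∣ D → ¬ q ∣ T → ((D.choose T : ℕ) : K) = 0) {t : ℕ} (hNt : N ≤ t) {i j l : Fin 3}
    {k m : ℕ} (hS : IsRunState W s t i j l k m) (hm : q ≤ m + s) (hjt : W.j t = i) (hbj : W.b t j ≠ 0)
    (hloss : IsLossMove W t) (hst : StaysOnNewest W t) (hl1 : W.j (t + 1) = l) :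
    ∃ u : ℕ, t < u ∧ ∃ (i' j' l' : Fin 3) (k' m' : ℕ), IsRunState W s u i' j' l' k' m' ∧ q ≤ m' + s ∧
      runBeta W s u i' j' l' < runBeta W s t i j l := by
  classical
  obtain ⟨hord, hq, hks, hms, -⟩ := runState_ledger hroot hT hNt hS
  obtain ⟨hri, hrj, hrl⟩ := hS.r_apply
  have hij : i ≠ j := hS.1
  have hli : l ≠ i := hS.2.1
  have hlj : l ≠ j := hS.2.2.1
  have hsq : s < q := hT.s_lt
  have h1s : 1 ≤ s := hT.one_le
  obtain ⟨φ₀, lam, hφ₀, hbl, hpen⟩ := pencil_of_loss_a hroot hT hNt hS hjt hbj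
  have hro : (W.st t).r.degree + s = k + m + s := by
    rw [hS.2.2.2.2.2.1, map_add, Finsupp.degree_single, Finsupp.degree_single]
  obtain ⟨T, hoT, h1T, hr1, hqT, hnext⟩ := lossMove_next hroot hT hNt hloss
  have hTo : q + T = k + m + s := by
    have h := hord.symm.trans hoT
    have h' : s + k + m = q + T := by exact_mod_cast h
    omega
  rcases hnext with ⟨hnst, -, -⟩ | ⟨-, l₂, d, hl₂i, hl₂j, hTd, h1d, hS2⟩
  · exact absurd hst hnst
  rw [hl1] at hS2 hl₂i
  rw [hjt] at hS2 hl₂j hr1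
  have hl₂ : l₂ = j := by
    rcases fin3_eq_or i j l l₂ hij hli.symm (Ne.symm hlj) with h | h | h
    · exact absurd h hl₂j
    · exact h
    · exact absurd h hl₂i
  rw [hl₂] at hS2
  have hS2' : IsRunState W s (t + 1 + 1) l i j d T := hS2
  refine ⟨t + 1 + 1, by omega, l, i, j, d, T, hS2', hqT.le, ?_⟩
  have hbi1 : W.b (t + 1) i = 0 := by have := hst.2; rwa [hjt] at this
  -- the equations
  have hF1 : (W.st (t + 1)).F =
      deletePthPowers q (chartTransform q i (shear j i (W.b t j) (shear l i (lam * W.b t j) (W.st t).F))) := by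
    rw [st_succ_F_two_shears hroot W t hij.symm hli hlj.symm hjt, hbl]
  set Ga : MvPolynomial (Fin 3) K := shear j i (W.b t j) (shear l i (lam * W.b t j) (W.st t).F) with hGa
  set φ : K := (W.b t j)⁻¹ with hφdef
  have hφβ : φ * W.b t j = 1 := inv_mul_cancel₀ hbj
  have hφ : φ ≠ 0 := inv_ne_zero hbj
  have hF2 : (W.st (t + 1 + 1)).F = deletePthPowers q (chartTransform q l (shear j l (W.b (t + 1) j) (W.st (t + 1)).F)) := by
    rw [st_succ_F_two_shears hroot W (t + 1) hli.symm hlj.symm hij hl1, hbi1, shear_zero]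
  -- degrees
  have hdegF : ∀ D ∈ (W.st t).F.support, k + m + s ≤ D.degree := fun D hD =>
    le_degree_of_mem_support_runState hroot hT hNt hS hD
  have hoGa : ∀ E ∈ Ga.support, k + m + s ≤ E.degree := fun E hE =>
    le_degree_of_mem_support_shear hli.symm hij hlj (W.b t j)
      (fun E' hE' => le_degree_of_mem_support_shear hij hli.symm hlj.symm (lam * W.b t j) hdegF hE') hE
  have hqGa : ∀ E ∈ Ga.support, q ≤ E.degree := fun E hE => by have := hoGa E hE; omega
  have hqF1 : ∀ D ∈ (W.st (t + 1)).F.support, q ≤ D.degree := fun D hD => le_degree_of_mem_support hroot W (t + 1) hD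
  have hqF1σ : ∀ g : K, ∀ D ∈ (shear j l g (W.st (t + 1)).F).support, q ≤ D.degree := fun g D hD =>
    le_degree_of_mem_support_shear hli hlj hij g hqF1 hD
  have hoGaσ : ∀ g : K, ∀ E ∈ (shear j l g Ga).support, k + m + s ≤ E.degree := fun g E hE =>
    le_degree_of_mem_support_shear hli hlj hij g hoGa hE
  have hqGaσ : ∀ g : K, ∀ E ∈ (shear j l g Ga).support, q ≤ E.degree := fun g E hE => by have := hoGaσ g E hE; omega
  -- FORCING: the repeat translates by `b_{t+1}(j) = μ'` with `λ μ' = 1`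
  have hord2 : ordZero (W.st (t + 1 + 1)).F = ((s + d + T : ℕ) : ℕ∞) := (runState_ledger hroot hT (by omega) hS2').1
  set A : Fin 3 →₀ ℕ := Finsupp.single i T + Finsupp.single l s with hA
  have hAi : A i = T := by simp [hA, hli.symm]
  have hAl : A l = s := by simp [hA, hli]
  have hAj : A j = 0 := by simp [hA, Ne.symm hij, Ne.symm hlj]
  have hAdeg : A.degree = T + s := by rw [hA, map_add, Finsupp.degree_single, Finsupp.degree_single]
  have hqA : q ≤ A.degree := by rw [hAdeg]; omega
  have hPA : ¬ IsPthPowerExponent q A := by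
    rw [isPthPowerExponent_iff_of_fin3 hij hli.symm hlj.symm, hAl]
    intro h
    exact absurd (Nat.le_of_dvd (by omega) h.2.2) (by omega)
  set B : Fin 3 →₀ ℕ := Finsupp.single i ((W.st t).r i + (W.st t).r j) + Finsupp.single l s with hB
  have hBdeg : B.degree = k + m + s := by rw [hB, map_add, Finsupp.degree_single, Finsupp.degree_single, hri, hrj]
  have hqB : q ≤ B.degree := by rw [hBdeg]; omega
  have hcEB : chartExponent q i B = A := by
    ext w
    rcases fin3_eq_or i j l w hij hli.symm (Ne.symm hlj) with h | h | h <;> rw [h]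
    · rw [chartExponent_apply, if_pos rfl, hBdeg, hAi]; omega
    · rw [chartExponent_apply, if_neg (Ne.symm hij), hAj, hB, Finsupp.add_apply, Finsupp.single_apply, if_neg hij,
        Finsupp.single_apply, if_neg hlj, add_zero]
    · rw [chartExponent_apply, if_neg hli, hAl, hB, Finsupp.add_apply, Finsupp.single_apply, if_neg (Ne.symm hli),
        Finsupp.single_eq_same, zero_add]
  have hμ' : lam * W.b (t + 1) j = 1 := by
    set μ' : K := W.b (t + 1) j with hμdef
    have hvan : coeff (chartExponent q l A) (W.st (t + 1 + 1)).F = 0 := by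
      refine coeff_eq_zero_of_degree_lt_ordZero ?_
      have hdeg : (chartExponent q l A).degree = T + d := by
        rw [degree_fin3 hij hli.symm hlj.symm, chartExponent_apply, if_neg hli.symm, chartExponent_apply, if_neg (Ne.symm hlj),
          chartExponent_apply, if_pos rfl, hAi, hAj, hAdeg]
        omega
      rw [hord2, hdeg]
      exact_mod_cast (by omega : T + d < s + d + T)
    have h1 : coeff (chartExponent q l A) (W.st (t + 1 + 1)).F = coeff A (shear j l μ' (W.st (t + 1)).F) := by
      rw [coeff_succ_two_shears hroot W (t + 1) hli.symm hlj.symm hij hl1 hqA hPA, hbi1, shear_zero]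
    have h2 : coeff A (shear j l μ' (W.st (t + 1)).F) = coeff B (shear j l μ' Ga) := by
      have h : coeff A (deletePthPowers q (shear j l μ' (W.st (t + 1)).F)) = coeff A (shear j l μ' (W.st (t + 1)).F) := by
        rw [coeff_deletePthPowers, if_neg hPA]
      rw [← h, hF1, deletePthPowers_shear_deletePthPowers_chartTransform hli hlj hij hLucas μ' hqGa,
        coeff_deletePthPowers, if_neg hPA, ← hcEB, coeff_chartTransform_chartExponent_of_le (hqGaσ μ') hqB]
    have h3 : coeff B (shear j l μ' Ga) = φ₀ * W.b t j ^ ((W.st t).r j) * (1 - lam * μ') ^ s := by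
      rw [hGa]
      exact coeff_shears_a2_apex hij hli.symm hlj.symm hrl hro φ₀ lam (W.b t j) μ' (walk_r hroot W t) hpen
    have h0 : φ₀ * W.b t j ^ ((W.st t).r j) * (1 - lam * μ') ^ s = 0 := by rw [← h3, ← h2, ← h1, hvan]
    rcases mul_eq_zero.mp h0 with h | h
    · rcases mul_eq_zero.mp h with h' | h'
      · exact absurd h' hφ₀
      · exact absurd (pow_eq_zero_iff (by rw [hrj]; omega) |>.mp h') hbj
    · exact (sub_eq_zero.mp (pow_eq_zero_iff (by omega) |>.mp h)).symm
  have hlam : lam ≠ 0 := left_ne_zero_of_mul_eq_one hμ'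
  have hμ'ne : W.b (t + 1) j ≠ 0 := right_ne_zero_of_mul_eq_one hμ'
  have hνl : W.b (t + 1) j * lam = 1 := by rw [mul_comm]; exact hμ'
  -- the (c)-type preparation `Gc'` and the swap identity
  set γ : K := W.b (t + 1) j * φ with hγdef
  have hγ : γ ≠ 0 := mul_ne_zero hμ'ne hφ
  have hg : lam * W.b t j ≠ 0 := mul_ne_zero hlam hbj
  have hγg : γ * (lam * W.b t j) = 1 := by
    calc γ * (lam * W.b t j) = (lam * W.b (t + 1) j) * (φ * W.b t j) := by rw [hγdef]; ring
      _ = 1 := by rw [hμ', hφβ, one_mul]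
  set Gc : MvPolynomial (Fin 3) K := shear i l γ (shear j l (W.b (t + 1) j) (W.st t).F) with hGc
  set G2 : MvPolynomial (Fin 3) K := shear j l (W.b (t + 1) j) Ga with hG2
  have hSw2 : G2 = swapShear i l γ (lam * W.b t j) Gc := shears_a2_eq_swapShear hij hli.symm hlj.symm hμ' hφβ _
  have hSw2' : swapShear l i (lam * W.b t j) γ G2 = Gc := by rw [hSw2, swapShear_swapShear hij.symm hlj.symm hli.symm hγg]
  -- the (b)-type preparation `Gb` and the `(j,l)`-swap identity of §10
  set Gb : MvPolynomial (Fin 3) K := shear i j (γ * lam) (shear l j lam (W.st t).F) with hGb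
  have hSw : swapShear j l (W.b (t + 1) j) lam Gc = shear i l γ Gb :=
    swapShear_shear_shear hij hli.symm (Ne.symm hlj) hνl γ (W.st t).F
  have hSw' : swapShear l j lam (W.b (t + 1) j) (shear i l γ Gb) = Gc := by
    rw [← hSw, swapShear_swapShear hij hli.symm (Ne.symm hlj) hνl]
  -- degrees
  have hoGc : ∀ E ∈ (deletePthPowers q Gc).support, k + m + s ≤ E.degree := fun E hE => by
    rw [support_deletePthPowers'] at hE
    exact le_degree_of_mem_support_prepared_c hroot hT hNt hS _ _ (Finset.mem_filter.mp hE).1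
  have hoGb : ∀ D ∈ (deletePthPowers q Gb).support, k + m + s ≤ D.degree := fun D hD => by
    rw [support_deletePthPowers'] at hD
    exact le_degree_of_mem_support_prepared hroot hT hNt hS _ _ (Finset.mem_filter.mp hD).1
  have hoS : ∀ E' ∈ (deletePthPowers q (shear i l γ Gb)).support, k + m + s ≤ E'.degree := fun E' hE' => by
    rw [support_deletePthPowers'] at hE'
    exact le_degree_of_mem_support_shear hlj hli hij.symm γ
      (fun D hD => le_degree_of_mem_support_prepared hroot hT hNt hS _ _ hD) (Finset.mem_filter.mp hE').1
  have hoG2 : ∀ E' ∈ (deletePthPowers q G2).support, k + m + s ≤ E'.degree := fun E' hE' => by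
    rw [support_deletePthPowers'] at hE'
    exact hoGaσ _ E' (Finset.mem_filter.mp hE').1
  have hqG2 : ∀ E ∈ G2.support, q ≤ E.degree := hqGaσ _
  -- no degree-`o` monomial of `Gb` lies below the ceiling
  have hthd : ∀ D ∈ (deletePthPowers q Gb).support, D l < s → k + m + s < D.degree := by
    intro D hD hDl
    rcases (hoGb D hD).lt_or_eq with hlt | heq
    · exact hlt
    · exfalso
      rw [support_deletePthPowers'] at hD
      have := thd_eq_of_mem_support_two_shears hij hli.symm (Ne.symm hlj) hrl hro φ₀ lam (γ * lam)
        (walk_r hroot W t) hpen (Finset.mem_filter.mp hD).1 heq.symm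
      omega
  -- the polygon two moves later: `F_{t+2} = clean chart_l clean chart_i G₂`
  obtain ⟨hr₂l, hr₂i, hr₂j⟩ := hS2'.r_apply
  have hr₁i : (W.st (t + 1)).r i = T := by rw [hr1, Finsupp.single_eq_same]
  have hr₁j : (W.st (t + 1)).r j = 0 := by rw [hr1, Finsupp.single_apply, if_neg hij]
  have hr₁l : (W.st (t + 1)).r l = 0 := by rw [hr1, Finsupp.single_apply, if_neg hli.symm]
  have hclean2 : deletePthPowers q (shear j l (W.b (t + 1) j) (W.st (t + 1)).F) =
      deletePthPowers q (chartTransform q i G2) := by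
    rw [hF1, hG2]
    exact deletePthPowers_shear_deletePthPowers_chartTransform hli hlj hij hLucas _ hqGa
  have hP2 : polyPts s (W.st (t + 1 + 1)).r i l j (W.st (t + 1 + 1)).F =
      (entryPts s (k + m + s) l j (deletePthPowers q G2)).image psi01 := by
    rw [hF2, polyPts_clean_chart_snd hli.symm hij hlj (r := (W.st (t + 1)).r) (by rw [hr₂i, hr₁i])
      (by rw [hr₂l, hr₁i, hr₁l]; omega) hr₁j hr₂j (hqF1σ _), hclean2,
      polyPts_clean_chart_eq_entryPts hli.symm hij hr₁i hr₁l hr₁j hTo hqG2]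
  -- the axis witness at `t + 2` (pair `(i, j)`), transported to `clean G_b`
  have hos : 2 * q + 1 ≤ k + m + s + s := by omega
  obtain ⟨R, hR, hax, hRl⟩ : ∃ R ∈ (deletePthPowers q Gb).support, R.degree + R l < 2 * q ∧ R l < s := by
    obtain ⟨M, hM, hMlt⟩ := ConeCutAxisLaw.axis_law W (t + 1 + 1) i j hij
    rw [hF2, support_deletePthPowers_chartTransform l _ (hqF1σ _)] at hM
    obtain ⟨D', hD', hMD⟩ := Finset.mem_image.mp hM
    have hD'c : D' ∈ (deletePthPowers q (shear j l (W.b (t + 1) j) (W.st (t + 1)).F)).support := by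
      rw [support_deletePthPowers']; exact hD'
    rw [hclean2, support_deletePthPowers_chartTransform i _ hqG2] at hD'c
    obtain ⟨E', hE', hD'E⟩ := Finset.mem_image.mp hD'c
    have hE'c : E' ∈ (deletePthPowers q G2).support := by rw [support_deletePthPowers']; exact hE'
    have hqE' : q ≤ E'.degree := hqG2 E' (Finset.mem_filter.mp hE').1
    have hE'ax : E'.degree + E' j < 2 * q := by
      have h1 : M i = E'.degree - q := by
        rw [← hMD, chartExponent_apply, if_neg hli.symm, ← hD'E, chartExponent_apply, if_pos rfl]
      have h2 : M j = E' j := by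
        rw [← hMD, chartExponent_apply, if_neg (Ne.symm hlj), ← hD'E, chartExponent_apply, if_neg (Ne.symm hij)]
      omega
    obtain ⟨E, hE, hEj, hEdeg, hEi⟩ := exists_dom_swapShear (Ne.symm hlj) hij.symm hli hg hγ hLucas G2 hE'c
    rw [hSw2'] at hE
    obtain ⟨E₁, hE₁, -, hE₁deg, hE₁l⟩ := exists_dom_swapShear hij hli.symm (Ne.symm hlj) hμ'ne hlam hLucas Gc hE
    rw [hSw] at hE₁
    obtain ⟨D, hD, -, hDdeg, hDor⟩ := exists_dom_of_mem_support_shear hlj hli hij.symm hLucas γ Gb hE₁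
    have hDl : D l ≤ E₁ l := by
      rcases hDor with rfl | hlt
      · exact le_rfl
      · exact hlt.le
    have hoD := hoGb D hD
    exact ⟨D, hD, by omega, by omega⟩
  have hneEPb : (entryPts s (k + m + s) i l (deletePthPowers q Gb)).Nonempty := ⟨_, entryPt_mem_entryPts _ _ _ _ _ hR hRl⟩
  -- vertex transport `EP(Gb; i,l) = EP(σ_{i,l,γ} Gb; i,l)` (outer shear) …
  have h32 := vertexOf_entryPts_eq_of_dom (s := s) (o := k + m + s) (a := i) (c := l) (a' := i) (c' := l)
    (G := deletePthPowers q Gb) (G' := deletePthPowers q (shear i l γ Gb))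
    (fun D hD hDl => by
      obtain ⟨E', hE', -, hE'deg, hE'or⟩ := exists_dom_shear_of_mem_support hlj hli hij.symm hLucas γ Gb hD
      rcases hE'or with rfl | hlt
      · exact ⟨_, hE', hDl, le_rfl⟩
      · exact ⟨E', hE', by omega, toLex_entryPt_le_of_lt hE'deg (hthd D hD hDl) hlt hDl⟩)
    (fun E' hE' hE'l => by
      obtain ⟨D, hD, -, hDdeg, hDor⟩ := exists_dom_of_mem_support_shear hlj hli hij.symm hLucas γ Gb hE'
      rcases hDor with rfl | hlt
      · exact ⟨_, hD, hE'l, le_rfl⟩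
      · have hDl : D l < s := by omega
        exact ⟨D, hD, hDl, toLex_entryPt_le_of_lt hDdeg (by rw [← hDdeg]; exact hthd D hD hDl) hlt hE'l⟩)
    hneEPb
  -- … `EP(σ_{i,l,γ} Gb; i,l) = EP(Gc'; i,j)` (the `(j,l)`-swap, both ways) …
  have h21 := vertexOf_entryPts_eq_of_dom (s := s) (o := k + m + s) (a := i) (c := l) (a' := i) (c' := j)
    (G := deletePthPowers q (shear i l γ Gb)) (G' := deletePthPowers q Gc)
    (fun E' hE' hE'l => by
      obtain ⟨E, hE, hEi, hEdeg, hEj⟩ := exists_dom_swapShear hli.symm hij hlj hlam hμ'ne hLucas _ hE'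
      rw [hSw'] at hE
      exact ⟨E, hE, by omega, toLex_entryPt_le hEdeg (hoS E' hE') hEi.le hEj hE'l⟩)
    (fun E hE hEj => by
      obtain ⟨E', hE', hE'i, hE'deg, hE'l⟩ := exists_dom_swapShear hij hli.symm (Ne.symm hlj) hμ'ne hlam hLucas Gc hE
      rw [hSw] at hE'
      exact ⟨E', hE', by omega, toLex_entryPt_le hE'deg (hoGc E hE) hE'i.le hE'l hEj⟩)
    h32.1
  -- … and `EP(Gc'; i,j) = EP(G₂; l,j)` (the `(i,l)`-swap, both ways)
  have h10 := vertexOf_entryPts_eq_of_dom (s := s) (o := k + m + s) (a := i) (c := j) (a' := l) (c' := j)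
    (G := deletePthPowers q Gc) (G' := deletePthPowers q G2)
    (fun E hE hEj => by
      obtain ⟨E', hE', hE'j, hE'deg, hE'l⟩ := exists_dom_swapShear hij.symm (Ne.symm hlj) hli.symm hγ hg hLucas Gc hE
      rw [← hSw2] at hE'
      exact ⟨E', hE', by omega, toLex_entryPt_le hE'deg (hoGc E hE) hE'l hE'j.le hEj⟩)
    (fun E' hE' hE'j => by
      obtain ⟨E, hE, hEj, hEdeg, hEi⟩ := exists_dom_swapShear (Ne.symm hlj) hij.symm hli hg hγ hLucas G2 hE'
      rw [hSw2'] at hE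
      exact ⟨E, hE, by omega, toLex_entryPt_le hEdeg (hoG2 E' hE') hEi hEj.le hE'j⟩)
    h21.1
  have hV : vertexOf (entryPts s (k + m + s) l j (deletePthPowers q G2)) =
      vertexOf (entryPts s (k + m + s) i l (deletePthPowers q Gb)) := by rw [h32.2, h21.2, h10.2]
  have hne2 : (entryPts s (k + m + s) l j (deletePthPowers q G2)).Nonempty := h10.1
  -- the entry law T8b for `Gb`
  have hqj : q ≤ s + (W.st t).r j := by rw [hrj]; omega
  have h8 := entry_lt_betaOf_of_axisWitness hij hli.symm (Ne.symm hlj) hrl (mul_ne_zero hγ hlam) lam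
    (fun D hD => not_isPthPowerExponent_of_mem_support hroot W t hD) (walk_r hroot W t)
    (fun D hD => by rw [hri, hrj]; exact le_degree_of_mem_support_runState hroot hT hNt hS hD)
    (polyPts_nonempty_of_heavy_fst hroot W t (Ne.symm hlj) i hqj hrl)
    (alphaOf_polyPts_lt_one hroot W t (Ne.symm hlj) i hqj hrl) hsq (by rw [hri, hrj]; omega) (by rw [hri, hrj]; omega)
    hR hax
  rw [hri, hrj] at h8
  unfold runBeta
  rw [hP2, betaOf_image_psi01 hne2]
  unfold alphaOf betaOf at h8 ⊢
  rw [hV]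
  exact h8

end WalkA2

end Summit.ResolutionOfSingularities.ResolutionOfSingularities.Theorems.LossEpisode
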